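import Mathlib.GroupTheory.OrderOfElement
import Summits.MatrixMultiplication.OmegaCensus.DihedralLawModOneCubeAlignedPair
import HarnessLib

/-!
# Near-periodic half-sets in a finite abelian group

ω-census, family (b3).  Framing: lottery ticket; floor = certified bounds/negative ranges.

Two elementary tools for the alignment lemma of the cube law shapes (`FAMILY-B-ADDENDUM-g4.md` §7, Lemma Q):

* `addOrderOf_dvd_card_of_forall_add_mem`: a `u`-invariant finite set has cardinality divisible by `ord(u)`.
* `two_mul_eq_of_near_periodic_half_set` (**near-periodic half-set**): if `W ⊆ A` satisfies the indicator identity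
  `𝟙_W(y) − 𝟙_W(y − u) = [y = x₁] − [y = x₀]` for all `y` (i.e. `W` and `W + u` differ exactly in the two points
  `x₀ ∈ (W+u) ∖ W`, `x₁ ∈ W ∖ (W+u)`), `u ≠ 0`, and `2|W| + 1 = |A|`, then **`2(x₁ − x₀) = u`**: `W` consists of
  full `⟨u⟩`-cosets together with the half-segment `{x₁, x₁ + u, …, x₀ − u}` of the coset of `x₀`, and counting
  `|W|` modulo `ord(u)` pins the segment length to `(ord(u) − 1)/2`.

In the alignment lemma these apply to `W₁ = (M+t) ⊔ P` with step `t′ − t` and `W₂ = M ⊔ P` with step `t + t′`,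
giving the hole relations `x₀′ = x₀ + (t′−t)/2`, `x₀′ + t = x₀ + (t+t′)/2`.
-/

namespace Summit.MatrixMultiplication.OmegaCensus

open Finset

section NearPeriodic

variable {A : Type*} [AddCommGroup A] [Fintype A] [DecidableEq A]

/-- The coset `s + ⟨u⟩` lies in any `u`-invariant set containing `s`. [folklore] -/
theorem coset_subset_of_forall_add_mem {S : Finset A} {u s : A} (hS : ∀ y ∈ S, y + u ∈ S) (hs : s ∈ S) :
    (univ.filter fun y : A => y - s ∈ AddSubgroup.zmultiples u) ⊆ S := by
  intro y hy
  rw [mem_filter] at hy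
  obtain ⟨n, -, hn⟩ := mem_image.1 ((mem_zmultiples_iff_mem_range_addOrderOf).1 hy.2)
  have key : ∀ m : ℕ, s + m • u ∈ S := by
    intro m
    induction m with
    | zero => simpa using hs
    | succ m ih => rw [succ_nsmul, ← add_assoc]; exact hS _ ih
  have e : y = s + n • u := by rw [hn]; abel
  rw [e]; exact key n

/-- **A `u`-invariant finite set has cardinality divisible by `ord(u)`.** [folklore] -/
theorem addOrderOf_dvd_card_of_forall_add_mem {S : Finset A} {u : A} (hS : ∀ y ∈ S, y + u ∈ S) :
    addOrderOf u ∣ S.card := by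
  suffices H : ∀ n : ℕ, ∀ S : Finset A, S.card = n → (∀ y ∈ S, y + u ∈ S) → addOrderOf u ∣ S.card from
    H _ S rfl hS
  intro n
  induction n using Nat.strong_induction_on with
  | h n ih =>
  intro S hn hS
  rcases S.eq_empty_or_nonempty with rfl | ⟨s, hs⟩
  · simp
  · set K := univ.filter fun y : A => y - s ∈ AddSubgroup.zmultiples u with hK
    have hKS : K ⊆ S := coset_subset_of_forall_add_mem hS hs
    have cK : K.card = addOrderOf u := card_filter_sub_mem_zmultiples u s
    have hS' : ∀ y ∈ S \ K, y + u ∈ S \ K := by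
      intro y hy
      rw [mem_sdiff] at hy ⊢
      refine ⟨hS y hy.1, fun h => hy.2 ?_⟩
      rw [hK, mem_filter] at h ⊢
      refine ⟨mem_univ _, ?_⟩
      have e : y - s = (y + u - s) - u := by abel
      rw [e]; exact (AddSubgroup.zmultiples u).sub_mem h.2 (AddSubgroup.mem_zmultiples u)
    have hlt : (S \ K).card < n := by
      rw [card_sdiff_of_subset hKS, cK, ← hn]
      have : 0 < addOrderOf u := addOrderOf_pos u
      have : K.card ≤ S.card := card_le_card hKS
      omega
    have hdvd := ih _ hlt _ rfl hS'
    have e : S.card = (S \ K).card + addOrderOf u := by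
      rw [card_sdiff_of_subset hKS, cK]; have := card_le_card hKS; omega
    rw [e]
    exact dvd_add hdvd (dvd_refl _)

/-- **Near-periodic half-set.** If `𝟙_W(y) − 𝟙_W(y−u) = [y = x₁] − [y = x₀]` for all `y`, `u ≠ 0` and
`2|W| + 1 = |A|`, then `2(x₁ − x₀) = u`. [folklore] -/
theorem two_mul_eq_of_near_periodic_half_set {W : Finset A} {u x₀ x₁ : A} (hu : u ≠ 0)
    (hW : ∀ y : A, ((if y ∈ W then (1 : ℤ) else 0) - (if y - u ∈ W then 1 else 0)) =
      (if y = x₁ then (1 : ℤ) else 0) - (if y = x₀ then 1 else 0))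
    (hcard : 2 * W.card + 1 = Fintype.card A) :
    (x₁ - x₀) + (x₁ - x₀) = u := by
  set k := addOrderOf u with hk
  have hkpos : 0 < k := addOrderOf_pos u
  have hkN : k ∣ Fintype.card A := addOrderOf_dvd_card
  have hk2 : 2 ≤ k := by
    by_contra h
    have hk1 : addOrderOf u = 1 := by omega
    exact hu (AddMonoid.addOrderOf_eq_one_iff.1 hk1)
  -- `x₀ ≠ x₁`: otherwise `W` would be `u`-invariant, `k ∣ |W|` and `k ∣ 2|W|+1`
  have hne : x₀ ≠ x₁ := by
    intro h
    subst h
    have hinv : ∀ y ∈ W, y + u ∈ W := by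
      intro y hy
      have h1 := hW (y + u)
      rw [sub_self, add_sub_cancel_right, if_pos hy] at h1
      by_contra hc
      rw [if_neg hc] at h1
      omega
    have h1 := addOrderOf_dvd_card_of_forall_add_mem hinv
    rw [← hk] at h1
    have h2 : k ∣ 1 := by
      have : k ∣ 2 * W.card + 1 := hcard ▸ hkN
      exact (Nat.dvd_add_right (dvd_mul_of_dvd_right h1 2)).1 this
    have := Nat.le_of_dvd one_pos h2
    omega
  -- the four boundary memberships
  have hx₀ : x₀ ∉ W := by
    intro h
    have h1 := hW x₀
    rw [if_pos h, if_neg hne, if_pos rfl] at h1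
    split_ifs at h1 <;> omega
  have hx₀u : x₀ - u ∈ W := by
    have h1 := hW x₀
    rw [if_neg hx₀, if_neg hne, if_pos rfl] at h1
    by_contra hc; rw [if_neg hc] at h1; omega
  have hx₁ : x₁ ∈ W := by
    have h1 := hW x₁
    rw [if_pos rfl, if_neg (Ne.symm hne)] at h1
    by_contra hc; rw [if_neg hc] at h1; split_ifs at h1 <;> omega
  have hstep : ∀ y : A, y ≠ x₀ → y ≠ x₁ → (y ∈ W ↔ y - u ∈ W) := by
    intro y h0 h1
    have h := hW y
    rw [if_neg h0, if_neg h1] at h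
    constructor
    · intro hy; rw [if_pos hy] at h; by_contra hc; rw [if_neg hc] at h; omega
    · intro hy; rw [if_pos hy] at h; by_contra hc; rw [if_neg hc] at h; omega
  -- multiples of `u`
  have hmul_ne : ∀ n : ℕ, 0 < n → n < k → n • u ≠ 0 := fun n hn hnk =>
    nsmul_ne_zero_of_lt_addOrderOf (Nat.pos_iff_ne_zero.1 hn) hnk
  -- `x₁` lies in the coset of `x₀`: otherwise walk from `x₀` (∉ W) to `x₀ + (k-1)•u = x₀ - u` (∈ W)
  have hx₁coset : x₁ - x₀ ∈ AddSubgroup.zmultiples u := by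
    by_contra hnot
    have walk : ∀ n : ℕ, n < k → x₀ + n • u ∉ W := by
      intro n
      induction n with
      | zero => intro _; simpa using hx₀
      | succ n ih =>
        intro hn
        have hy0 : x₀ + (n + 1) • u ≠ x₀ := by
          intro h
          have : (n + 1) • u = 0 := by
            have := congrArg (· - x₀) h; simpa using this
          exact hmul_ne (n + 1) (Nat.succ_pos n) hn this
        have hy1 : x₀ + (n + 1) • u ≠ x₁ := by
          intro h
          apply hnot
          rw [← h, add_sub_cancel_left]
          exact (AddSubgroup.zmultiples u).nsmul_mem (AddSubgroup.mem_zmultiples u) _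
        rw [hstep _ hy0 hy1, succ_nsmul, ← add_assoc, add_sub_cancel_right]
        exact ih (by omega)
    have h := walk (k - 1) (by omega)
    apply h
    have e : x₀ + (k - 1) • u = x₀ - u := by
      have h1 : (k - 1) • u + u = 0 := by
        rw [← succ_nsmul, Nat.sub_add_cancel (by omega : 1 ≤ k), hk, addOrderOf_nsmul_eq_zero]
      have h2 : (k - 1) • u = -u := eq_neg_of_add_eq_zero_left h1
      rw [h2, sub_eq_add_neg]
    rw [e]; exact hx₀u
  obtain ⟨j₀, hj₀k, hj₀⟩ := mem_image.1 ((mem_zmultiples_iff_mem_range_addOrderOf).1 hx₁coset)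
  rw [mem_range, ← hk] at hj₀k
  have hj₀pos : 0 < j₀ := by
    rcases Nat.eq_zero_or_pos j₀ with h | h
    · exfalso; rw [h, zero_nsmul] at hj₀; exact hne (sub_eq_zero.1 hj₀.symm).symm
    · exact h
  have hx₁e : x₁ = x₀ + j₀ • u := by rw [hj₀]; abel
  -- below `j₀`: not in `W`; from `j₀` to `k - 1`: in `W`
  have below : ∀ n : ℕ, n < j₀ → x₀ + n • u ∉ W := by
    intro n
    induction n with
    | zero => intro _; simpa using hx₀
    | succ n ih =>
      intro hn
      have hy0 : x₀ + (n + 1) • u ≠ x₀ := by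
        intro h
        have : (n + 1) • u = 0 := by have := congrArg (· - x₀) h; simpa using this
        exact hmul_ne (n + 1) (Nat.succ_pos n) (by omega) this
      have hy1 : x₀ + (n + 1) • u ≠ x₁ := by
        rw [hx₁e]; intro h
        have h' : (n + 1) • u = j₀ • u := add_left_cancel h
        have := nsmul_injOn_Iio_addOrderOf (by simp [Set.mem_Iio]; omega) (by simp [Set.mem_Iio]; omega) h'
        omega
      rw [hstep _ hy0 hy1, succ_nsmul, ← add_assoc, add_sub_cancel_right]
      exact ih (by omega)
  have above : ∀ n : ℕ, j₀ ≤ n → n < k → x₀ + n • u ∈ W := by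
    intro n hjn hnk
    induction n with
    | zero =>
      have : j₀ = 0 := by omega
      omega
    | succ n ih =>
      rcases Nat.eq_or_lt_of_le hjn with h | h
      · rw [← h, ← hx₁e]; exact hx₁
      · have hy0 : x₀ + (n + 1) • u ≠ x₀ := by
          intro h'
          have : (n + 1) • u = 0 := by have := congrArg (· - x₀) h'; simpa using this
          exact hmul_ne (n + 1) (Nat.succ_pos n) hnk this
        have hy1 : x₀ + (n + 1) • u ≠ x₁ := by
          rw [hx₁e]; intro h'
          have h'' : (n + 1) • u = j₀ • u := add_left_cancel h'
          have := nsmul_injOn_Iio_addOrderOf (by simp [Set.mem_Iio]; omega) (by simp [Set.mem_Iio]; omega) h''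
          omega
        rw [hstep _ hy0 hy1, succ_nsmul, ← add_assoc, add_sub_cancel_right]
        exact ih (by omega) (by omega)
  -- the coset `L₀` of `x₀` and `W ∩ L₀ = {x₀ + n•u : j₀ ≤ n < k}`
  set L₀ := univ.filter fun y : A => y - x₀ ∈ AddSubgroup.zmultiples u with hL₀
  have cL₀ : L₀.card = k := card_filter_sub_mem_zmultiples u x₀
  have hWL₀ : W ∩ L₀ = (Finset.Ico j₀ k).image fun n : ℕ => x₀ + n • u := by
    ext y
    rw [mem_inter, mem_image]
    constructor
    · rintro ⟨hyW, hyL⟩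
      rw [hL₀, mem_filter] at hyL
      obtain ⟨n, hnk, hn⟩ := mem_image.1 ((mem_zmultiples_iff_mem_range_addOrderOf).1 hyL.2)
      rw [mem_range, ← hk] at hnk
      have e : y = x₀ + n • u := by rw [hn]; abel
      refine ⟨n, mem_Ico.2 ⟨?_, hnk⟩, e.symm⟩
      by_contra hlt
      exact below n (by omega) (e ▸ hyW)
    · rintro ⟨n, hn, rfl⟩
      rw [mem_Ico] at hn
      refine ⟨above n hn.1 hn.2, ?_⟩
      rw [hL₀, mem_filter]
      refine ⟨mem_univ _, ?_⟩
      rw [add_sub_cancel_left]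
      exact (AddSubgroup.zmultiples u).nsmul_mem (AddSubgroup.mem_zmultiples u) _
  have cWL₀ : (W ∩ L₀).card = k - j₀ := by
    rw [hWL₀, card_image_of_injOn, Nat.card_Ico]
    intro a ha b hb hab
    rw [coe_Ico, Set.mem_Ico] at ha hb
    have h' : a • u = b • u := add_left_cancel hab
    exact nsmul_injOn_Iio_addOrderOf (by simp [Set.mem_Iio]; omega) (by simp [Set.mem_Iio]; omega) h'
  -- `W \ L₀` is `u`-invariant
  have hinv : ∀ y ∈ W \ L₀, y + u ∈ W \ L₀ := by
    intro y hy
    rw [mem_sdiff] at hy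
    have hy0 : y + u ≠ x₀ := by
      intro h
      apply hy.2
      rw [hL₀, mem_filter]; refine ⟨mem_univ _, ?_⟩
      have e : y - x₀ = -u := by rw [← h]; abel
      rw [e]; exact (AddSubgroup.zmultiples u).neg_mem (AddSubgroup.mem_zmultiples u)
    have hy1 : y + u ≠ x₁ := by
      intro h
      apply hy.2
      rw [hL₀, mem_filter]; refine ⟨mem_univ _, ?_⟩
      have e : y - x₀ = (x₁ - x₀) - u := by rw [← h]; abel
      rw [e]; exact (AddSubgroup.zmultiples u).sub_mem hx₁coset (AddSubgroup.mem_zmultiples u)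
    rw [mem_sdiff]
    refine ⟨(hstep _ hy0 hy1).2 (by rw [add_sub_cancel_right]; exact hy.1), fun h => hy.2 ?_⟩
    rw [hL₀, mem_filter] at h ⊢
    refine ⟨mem_univ _, ?_⟩
    have e : y - x₀ = (y + u - x₀) - u := by abel
    rw [e]; exact (AddSubgroup.zmultiples u).sub_mem h.2 (AddSubgroup.mem_zmultiples u)
  obtain ⟨q, hq⟩ := addOrderOf_dvd_card_of_forall_add_mem hinv
  rw [← hk] at hq
  have cW : W.card = (k - j₀) + k * q := by
    rw [← cWL₀, ← hq, ← card_sdiff_add_card_inter W L₀]; ring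
  obtain ⟨n, hn⟩ := hkN
  -- `2 (k - j₀) + 2 k q + 1 = k n`, hence `(2 j₀) • u = u`
  have key : 2 * j₀ + k * n = 2 * (k * q) + 2 * k + 1 := by
    have := hcard; rw [cW, hn] at this; omega
  have hk0 : k • u = 0 := by rw [hk]; exact addOrderOf_nsmul_eq_zero u
  have hkmul : ∀ r : ℕ, (k * r) • u = 0 := by
    intro r
    induction r with
    | zero => simp
    | succ r ih => rw [Nat.mul_succ, add_nsmul, ih, hk0, zero_add]
  have h2 : (2 * j₀) • u = u := by
    have e1 : (2 * j₀ + k * n) • u = (2 * j₀) • u := by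
      rw [add_nsmul, hkmul n, add_zero]
    have e2 : (2 * (k * q) + 2 * k + 1) • u = u := by
      have : 2 * (k * q) + 2 * k + 1 = k * (2 * q + 2) + 1 := by ring
      rw [this, add_nsmul, one_nsmul, hkmul (2 * q + 2), zero_add]
    rw [← e1, key, e2]
  calc x₁ - x₀ + (x₁ - x₀) = (2 * j₀) • u := by rw [hx₁e, add_sub_cancel_left, two_mul, add_nsmul]
    _ = u := h2

end NearPeriodic

end Summit.MatrixMultiplication.OmegaCensus
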